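import Literature.AnabelianGeometry.EtaleTheta.Discharge.Sec5EnvAut

/-!
# [EtTh] §5, Theorem 5.10 (iii) discharged modulo Theorem 5.10 (ii) (pp. 334–335 / PDF pp. 108–109)

Mochizuki, *The étale theta function …*, Publ. RIMS **45** (2009) [cite: MochizukiEtTh2009, Thm 5.10 (iii) p.334 (PDF p.108)].
Seat abc-iut-L2-d4 (node `EtTh:Thm5.10(iii)`); PROOF-ONLY companion of `Discharge/Sec5EnvAut.lean` over abc-iut-L2-t4's
`FrobenioidMonoTheta(Env).lean`.  Thm 5.10 (iii): "there exists a commutative diagram [`Ψ^Aut ∘ ϵ = (κ ∘ ϵ) ∘ γ`] — where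
`κ` is an inner automorphism of `Aut_C(B_N)`; `γ` … determines an automorphism of mono-theta environments and is
compatible with the `Π^tp_X`-conjugacy class of automorphisms of `Π^tp_Y` induced by `Ψ^bs`".  The conclusions are
stated UNFOLDED (`∃ γ k, …`), independent of the binder shape of abc-iut-L2-t4's `MonoThetaEnvCompat`
(`Discharge/Sec5Thm510.lean` rewraps them).  PROVED for every instance of the §5 data MODULO exactly: Thm 5.10 (ii)
as typed (`PsiAutPreserves`); a representative `ψY` of the class of automorphisms of `Π^tp_X̲` induced by `Ψ^bs`,
lying over `Ψ^Aut` through `ρ` (Thm. 4.4 (i), Def. 4.1 (ii)) and preserving `Π^tp_Y̲`, `Π^tp_Ÿ̲` (Prop. 2.4); the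
stability under compatible pairs of the remaining Kummer part `DK` of `D` (vacuous for `DK = ∅`; in print
"`Ψ^birat_Aut` … preserve[s] `(K^×)^{1/N}`").  Route (p.335 (PDF p.109)): `κ = Inn(δ₁ · δ₂ · δ₃)`, `x₃ ∈ Π^tp_X̲` with
`ρ(x₃) = δ₃^bs` ("up to composition with an automorphism of `Π^tp_Ÿ` that extends to … `Π^tp_X`"); the pair
`(κ⁻¹ ∘ Ψ^Aut, Inn(x₃⁻¹) ∘ ψY)` is compatible (`isEnvCompatible_of_thm510ii`) and a compatible pair induces `γ`
(`exists_envIso`) — the Cor. 2.18 (iv) / `μ₂` steps of the printed proof are not needed (`γ` is written down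
directly).  HONEST FRAMING: a kernel-checked implication between typed statements; typed ≠ discharged; no side
taken on anything downstream. -/

namespace Literature.AnabelianGeometry.EtaleTheta

open CategoryTheory
open scoped Pointwise

universe w v v' u u'

namespace ThetaFrobenioid

variable {C : Type u} [Category.{v} C] {D : Type u'} [Category.{v'} D] {𝔉 : ThetaFrobenioid.{w} C D}

/-! ### A compatible pair preserves the mono-theta structure `(D, s^Θ)` on `E^Π_N` -/

section Structure

variable {Φ : Aut 𝔉.BN ≃* Aut 𝔉.BN} {ψ : 𝔉.PiX ≃ₜ* 𝔉.PiX}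

namespace IsEnvCompatible

variable (hc : 𝔉.IsEnvCompatible Φ ψ)
include hc

/-- `Φ` preserves `(O_K^×)^{1/N} = O^×(B_N) ∩ N(E_N)` (Lemma 5.8), elementwise.
[cite: MochizukiEtTh2009, Lem 5.8 p.331 (PDF p.105)] -/
theorem apply_mem_OKxRootN (h8 : 𝔉.ConstantsEqNormalizer) {u : Aut 𝔉.BN} (hu : u ∈ 𝔉.OKxRootN) :
    Φ u ∈ 𝔉.OKxRootN := by
  rw [h8] at hu ⊢
  exact ⟨(mem_iff_of_map_equiv_eq hc.map_units _).mpr hu.1,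
    map_mem_normalizer_of_map_equiv_eq hc.map_EN hu.2⟩

/-- `c(g) := Φ(s^⊓-gp_N(ρ g)) · s^⊓-gp_N(ρ(ψ g))⁻¹` is a unit (both factors lie over `ρ(ψ g)`).
[cite: MochizukiEtTh2009, Thm 5.10 (iii) p.335 (PDF p.109)] -/
theorem liftDefect_mem_units (hsec : 𝔉.SgpCapSection) (g : 𝔉.PiX) :
    Φ (𝔉.sgpCap (𝔉.ρ g)) * (𝔉.sgpCap (𝔉.ρ (ψ g)))⁻¹ ∈ 𝔉.units 𝔉.BN := by
  rw [𝔉.units_eq_ker, MonoidHom.mem_ker, map_mul, map_inv, hc.base, hsec, mul_inv_cancel]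

/-- `c(g)` normalises `E_N` (Lemma 5.9 (iii): `s^⊓-gp_N(ρ(−))` does, and `Φ(E_N) = E_N`).
[cite: MochizukiEtTh2009, Thm 5.10 (iii) p.335 (PDF p.109)] -/
theorem liftDefect_mem_normalizer (h3 : 𝔉.OuterActionLZ) (g : 𝔉.PiX) :
    Φ (𝔉.sgpCap (𝔉.ρ g)) * (𝔉.sgpCap (𝔉.ρ (ψ g)))⁻¹ ∈
      Subgroup.normalizer (𝔉.EN : Set (Aut 𝔉.BN)) :=
  mul_mem (map_mem_normalizer_of_map_equiv_eq hc.map_EN (h3 ⟨g, Subgroup.mem_top g, rfl⟩))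
    (inv_mem (h3 ⟨ψ g, Subgroup.mem_top _, rfl⟩))

/-- The "constant" `c(g) := Φ(s^⊓-gp_N(ρ g)) · s^⊓-gp_N(ρ(ψ g))⁻¹` measuring the failure of `(Φ, ψ)` to
commute with the lift `g ↦ (s^⊓-gp_N(ρ g), g)` lies in `(O_K^×)^{1/N} = O^×(B_N) ∩ N(E_N)` (Lemma 5.8).
[cite: MochizukiEtTh2009, Thm 5.10 (iii) p.335 (PDF p.109)] -/
theorem liftDefect_mem (h3 : 𝔉.OuterActionLZ) (hsec : 𝔉.SgpCapSection)
    (h8 : 𝔉.ConstantsEqNormalizer) (g : 𝔉.PiX) :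
    Φ (𝔉.sgpCap (𝔉.ρ g)) * (𝔉.sgpCap (𝔉.ρ (ψ g)))⁻¹ ∈ 𝔉.OKxRootN := by
  rw [h8]
  exact Subgroup.mem_inf.mpr ⟨hc.liftDefect_mem_units hsec g, hc.liftDefect_mem_normalizer h3 g⟩

omit hc in
/-- `(Φ, ψ)(s^⊓-gp_N(ρ g), g) = (c(g), 1) · (s^⊓-gp_N(ρ(ψ g)), ψ g)`.
[cite: MochizukiEtTh2009, Thm 5.10 (iii) p.335 (PDF p.109)] -/
theorem ambientAut_liftPi (g : 𝔉.PiX) :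
    𝔉.ambientAut Φ ψ (𝔉.liftPi g) =
      ((Φ (𝔉.sgpCap (𝔉.ρ g)) * (𝔉.sgpCap (𝔉.ρ (ψ g)))⁻¹, 1) : Aut 𝔉.BN × 𝔉.PiX) *
        𝔉.liftPi (ψ g) := by
  rw [liftPi_apply, liftPi_apply, ambientAut_apply, Prod.mk_mul_mk, inv_mul_cancel_right, one_mul]

/-- **Transport of the `l·ℤ`-part of `D`**: `γ` carries the outer automorphism "conjugation by
`(s^⊓-gp_N(ρ g), g)`" (Lemma 5.9 (iii)) to the product of a constant outer automorphism (Lemma 5.8) and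
"conjugation by `(s^⊓-gp_N(ρ(ψ g)), ψ g)`".  [cite: MochizukiEtTh2009, Thm 5.10 (iii) p.335 (PDF p.109)] -/
theorem transport_galOut (h3 : 𝔉.OuterActionLZ) (hsec : 𝔉.SgpCapSection) (g : 𝔉.PiX) :
    TopOut.transport (𝔉.envAut (hc.stabilizesEPiN hsec))
        (𝔉.conjOut ⟨𝔉.liftPi g, 𝔉.liftPi_mem_normalizer h3 hsec g⟩) =
      𝔉.conjOut ⟨((Φ (𝔉.sgpCap (𝔉.ρ g)) * (𝔉.sgpCap (𝔉.ρ (ψ g)))⁻¹, 1) : Aut 𝔉.BN × 𝔉.PiX),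
          𝔉.liftConst_mem_normalizer (hc.liftDefect_mem_units hsec g)
            (hc.liftDefect_mem_normalizer h3 g)⟩ *
        𝔉.conjOut ⟨𝔉.liftPi (ψ g), 𝔉.liftPi_mem_normalizer h3 hsec (ψ g)⟩ := by
  rw [transport_envAut_conjOut, ← conjOut_mul]
  exact 𝔉.conjOut_congr (ambientAut_liftPi g)

/-- **Transport of the constants part of `D`**: `γ` carries "conjugation by `(u, 1)`", `u ∈ (O_K^×)^{1/N}`,
to "conjugation by `(Φ u, 1)`".  [cite: MochizukiEtTh2009, Thm 5.10 (iii) p.335 (PDF p.109)] -/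
theorem transport_constOut (hsec : 𝔉.SgpCapSection) (h8 : 𝔉.ConstantsEqNormalizer)
    (u : 𝔉.OKxRootN) :
    TopOut.transport (𝔉.envAut (hc.stabilizesEPiN hsec))
        (𝔉.conjOut ⟨((u : Aut 𝔉.BN), 1), by
          have hu : (u : Aut 𝔉.BN) ∈ 𝔉.units 𝔉.BN ⊓ Subgroup.normalizer (𝔉.EN : Set (Aut 𝔉.BN)) :=
            h8 ▸ u.2
          exact 𝔉.liftConst_mem_normalizer hu.1 hu.2⟩) =
      𝔉.conjOut ⟨((Φ u : Aut 𝔉.BN), 1), by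
          have hu : Φ u ∈ 𝔉.units 𝔉.BN ⊓ Subgroup.normalizer (𝔉.EN : Set (Aut 𝔉.BN)) :=
            h8 ▸ hc.apply_mem_OKxRootN h8 u.2
          exact 𝔉.liftConst_mem_normalizer hu.1 hu.2⟩ := by
  exact (transport_envAut_conjOut _ _).trans (𝔉.conjOut_congr (Prod.ext rfl (map_one ψ)))

/-- `γ` maps the subgroup `D = ⟨l·ℤ-part, (O_K^×)^{1/N}-part, DK⟩ ⊆ Out(E^Π_N)` into itself, provided it maps
the remaining Kummer part `DK` into `D`.  [cite: MochizukiEtTh2009, Thm 5.10 (iii) p.334 (PDF p.108)] -/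
theorem map_D_le (h1 : 𝔉.SectionsFactor) (h3 : 𝔉.OuterActionLZ) (hsec : 𝔉.SgpCapSection)
    (hcs : 𝔉.SgpCupSection) (h8 : 𝔉.ConstantsEqNormalizer) (DK : Set (TopOut 𝔉.EPiN))
    (hDK : ∀ d ∈ DK, TopOut.transport (𝔉.envAut (hc.stabilizesEPiN hsec)) d ∈
      (𝔉.frdMonoThetaEnv h1 h3 hsec hcs h8 DK).D) :
    ((𝔉.frdMonoThetaEnv h1 h3 hsec hcs h8 DK).D).map
        (TopOut.transport (𝔉.envAut (hc.stabilizesEPiN hsec))) ≤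
      (𝔉.frdMonoThetaEnv h1 h3 hsec hcs h8 DK).D := by
  change (Subgroup.closure (𝔉.galOut h3 hsec ∪ 𝔉.constOut h8 ∪ DK)).map _ ≤
    Subgroup.closure (𝔉.galOut h3 hsec ∪ 𝔉.constOut h8 ∪ DK)
  rw [MonoidHom.map_closure]
  apply (Subgroup.closure_le _).mpr
  rintro _ ⟨d, hd, rfl⟩
  rcases hd with (⟨g, rfl⟩ | ⟨u, rfl⟩) | hk
  · rw [hc.transport_galOut h3 hsec g]
    exact mul_mem
      (Subgroup.subset_closure (Or.inl (Or.inr ⟨⟨_, hc.liftDefect_mem h3 hsec h8 g⟩, rfl⟩)))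
      (Subgroup.subset_closure (Or.inl (Or.inl ⟨ψ g, rfl⟩)))
  · rw [hc.transport_constOut hsec h8 u]
    exact Subgroup.subset_closure (Or.inl (Or.inr ⟨⟨Φ u, hc.apply_mem_OKxRootN h8 u.2⟩, rfl⟩))
  · exact hDK d hk

/-- **`γ` maps `D` onto `D`** (given that `γ^{±1}` map `DK` into `D`). [cite: MochizukiEtTh2009, Thm 5.10 (iii) p.334 (PDF p.108)] -/
theorem map_D_eq_self (h1 : 𝔉.SectionsFactor) (h3 : 𝔉.OuterActionLZ) (hsec : 𝔉.SgpCapSection)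
    (hcs : 𝔉.SgpCupSection) (h8 : 𝔉.ConstantsEqNormalizer) (DK : Set (TopOut 𝔉.EPiN))
    (hDK : ∀ d ∈ DK, TopOut.transport (𝔉.envAut (hc.stabilizesEPiN hsec)) d ∈
      (𝔉.frdMonoThetaEnv h1 h3 hsec hcs h8 DK).D)
    (hDK' : ∀ d ∈ DK, TopOut.transport (𝔉.envAut ((hc.symm hsec).stabilizesEPiN hsec)) d ∈
      (𝔉.frdMonoThetaEnv h1 h3 hsec hcs h8 DK).D) :
    ((𝔉.frdMonoThetaEnv h1 h3 hsec hcs h8 DK).D).map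
        (TopOut.transport (𝔉.envAut (hc.stabilizesEPiN hsec))) =
      (𝔉.frdMonoThetaEnv h1 h3 hsec hcs h8 DK).D := by
  apply le_antisymm (hc.map_D_le h1 h3 hsec hcs h8 DK hDK)
  intro d hd
  exact ⟨_, (hc.symm hsec).map_D_le h1 h3 hsec hcs h8 DK hDK' ⟨d, hd, rfl⟩,
    transport_transport_symm_apply (𝔉.envAut (hc.stabilizesEPiN hsec)) d⟩

/-- `Φ` preserves the cyclotome `μ_N(B_N)` elementwise. [cite: MochizukiEtTh2009, Thm 5.10 (iii) p.335 (PDF p.109)] -/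
theorem apply_mem_muTorsion {u : Aut 𝔉.BN} (hu : u ∈ 𝔉.muTorsion 𝔉.BN 𝔉.N) :
    Φ u ∈ 𝔉.muTorsion 𝔉.BN 𝔉.N := by
  rw [mem_muTorsion] at hu ⊢
  exact ⟨(mem_iff_of_map_equiv_eq hc.map_units _).mpr hu.1, by rw [← map_pow, hu.2, map_one]⟩

/-- `γ(u, 1) = (Φ u, 1)` on the cyclotome `μ_N(B_N) ↪ E^Π_N`. [cite: MochizukiEtTh2009, Thm 5.10 (iii) p.335 (PDF p.109)] -/
theorem envAut_muIncl (hsec : 𝔉.SgpCapSection) (u : 𝔉.muTorsion 𝔉.BN 𝔉.N) :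
    𝔉.envAut (hc.stabilizesEPiN hsec) (𝔉.muIncl u) = 𝔉.muIncl ⟨Φ u, hc.apply_mem_muTorsion u.2⟩ := by
  apply Subtype.ext
  rw [coe_envAut, coe_muIncl, coe_muIncl, map_one]

/-- **`γ ∘ s^⊔-Π_N = s^⊔-Π_N ∘ ψ`** on `Π^tp_Ÿ̲`: since `Φ` preserves `Im(s^⊔-gp_N)` and lies over `ψ`, and
`s^⊔-gp_N` is a section.  [cite: MochizukiEtTh2009, Thm 5.10 (iii) p.335 (PDF p.109)] -/
theorem envAut_sCupPi (h1 : 𝔉.SectionsFactor) (hsec : 𝔉.SgpCapSection) (hcs : 𝔉.SgpCupSection)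
    (h : 𝔉.PiYdd) :
    𝔉.envAut (hc.stabilizesEPiN hsec) (𝔉.sCupPi h1 hcs h) =
      𝔉.sCupPi h1 hcs ⟨ψ h, (mem_iff_of_map_equiv_eq (Φ := ψ.toMulEquiv) hc.map_PiYdd _).mpr h.2⟩ := by
  obtain ⟨h', hh'⟩ : Φ (𝔉.sgpCup (𝔉.rhoYdd h)) ∈ 𝔉.sgpCup.range :=
    (mem_iff_of_map_equiv_eq hc.map_sgpCup _).mpr ⟨𝔉.rhoYdd h, rfl⟩
  have hb : 𝔉.autBase 𝔉.BN (Φ (𝔉.sgpCup (𝔉.rhoYdd h))) = 𝔉.ρ (ψ h) :=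
    hc.autBase_apply hsec (hcs (𝔉.rhoYdd h))
  rw [← hh', hcs h'] at hb
  have hh : h' = 𝔉.rhoYdd ⟨ψ h, (mem_iff_of_map_equiv_eq (Φ := ψ.toMulEquiv) hc.map_PiYdd _).mpr h.2⟩ :=
    Subtype.ext hb
  apply Subtype.ext
  rw [coe_envAut, coe_sCupPi, coe_sCupPi, ← hh', hh]

/-- `γ(Im(s^⊔-Π_N)) = Im(s^⊔-Π_N)`. [cite: MochizukiEtTh2009, Thm 5.10 (iii) p.335 (PDF p.109)] -/
theorem map_range_sCupPi (h1 : 𝔉.SectionsFactor) (hsec : 𝔉.SgpCapSection)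
    (hcs : 𝔉.SgpCupSection) :
    (𝔉.sCupPi h1 hcs).range.map (𝔉.envAut (hc.stabilizesEPiN hsec)).toMulEquiv.toMonoidHom =
      (𝔉.sCupPi h1 hcs).range := by
  ext x
  constructor
  · rintro ⟨_, ⟨h, rfl⟩, rfl⟩
    exact ⟨_, (hc.envAut_sCupPi h1 hsec hcs h).symm⟩
  · rintro ⟨h, rfl⟩
    have hmem : ψ.symm h ∈ 𝔉.PiYdd :=
      (mem_iff_of_map_equiv_eq (Φ := ψ.symm.toMulEquiv) (hc.symm hsec).map_PiYdd _).mpr h.2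
    refine ⟨𝔉.sCupPi h1 hcs ⟨ψ.symm h, hmem⟩, ⟨_, rfl⟩, ?_⟩
    change 𝔉.envAut (hc.stabilizesEPiN hsec) (𝔉.sCupPi h1 hcs ⟨ψ.symm h, hmem⟩) = _
    rw [hc.envAut_sCupPi h1 hsec hcs]
    exact congrArg (𝔉.sCupPi h1 hcs) (Subtype.ext (ψ.apply_symm_apply (h : 𝔉.PiX)))

omit hc in
/-- Conjugation commutes with an automorphism: `γ(a · H · a⁻¹) = γ(a) · γ(H) · γ(a)⁻¹`.
[cite: MochizukiEtTh2009, Thm 5.10 (iii) p.335 (PDF p.109)] -/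
theorem map_map_conj (γ : 𝔉.EPiN ≃* 𝔉.EPiN) (a : 𝔉.EPiN) (H : Subgroup 𝔉.EPiN) :
    (H.map (MulAut.conj a).toMonoidHom).map γ.toMonoidHom =
      (H.map γ.toMonoidHom).map (MulAut.conj (γ a)).toMonoidHom := by
  rw [Subgroup.map_map, Subgroup.map_map]
  congr 1
  exact MonoidHom.ext fun x => by
    simp only [MonoidHom.coe_comp, Function.comp_apply, MulEquiv.coe_toMonoidHom,
      MulAut.conj_apply, map_mul, map_inv]

/-- **`γ` maps the `μ_N`-conjugacy class of `Im(s^⊔-Π_N)` onto itself** (the `s^Θ` datum of the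
Frobenioid-theoretic mono-theta environment).  [cite: MochizukiEtTh2009, Thm 5.10 (iii) p.334 (PDF p.108)] -/
theorem image_sTheta (h1 : 𝔉.SectionsFactor) (hsec : 𝔉.SgpCapSection) (hcs : 𝔉.SgpCupSection) :
    (fun H : Subgroup 𝔉.EPiN =>
        H.map (𝔉.envAut (hc.stabilizesEPiN hsec)).toMulEquiv.toMonoidHom) ''
        𝔉.muConjClass (𝔉.sCupPi h1 hcs).range =
      𝔉.muConjClass (𝔉.sCupPi h1 hcs).range := by
  ext K
  constructor
  · rintro ⟨_, ⟨u, rfl⟩, rfl⟩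
    refine ⟨⟨Φ u, hc.apply_mem_muTorsion u.2⟩, ?_⟩
    change ((𝔉.sCupPi h1 hcs).range.map (MulAut.conj (𝔉.muIncl u)).toMonoidHom).map
        (𝔉.envAut (hc.stabilizesEPiN hsec)).toMulEquiv.toMonoidHom = _
    rw [map_map_conj, hc.map_range_sCupPi h1 hsec hcs]
    exact congrArg (fun w : 𝔉.EPiN => (𝔉.sCupPi h1 hcs).range.map (MulAut.conj w).toMonoidHom)
      (hc.envAut_muIncl hsec u)
  · rintro ⟨u', rfl⟩
    have hu : Φ.symm u' ∈ 𝔉.muTorsion 𝔉.BN 𝔉.N := (hc.symm hsec).apply_mem_muTorsion u'.2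
    refine ⟨(𝔉.sCupPi h1 hcs).range.map (MulAut.conj (𝔉.muIncl ⟨Φ.symm u', hu⟩)).toMonoidHom,
      ⟨⟨Φ.symm u', hu⟩, rfl⟩, ?_⟩
    change ((𝔉.sCupPi h1 hcs).range.map _).map
        (𝔉.envAut (hc.stabilizesEPiN hsec)).toMulEquiv.toMonoidHom = _
    rw [map_map_conj, hc.map_range_sCupPi h1 hsec hcs]
    refine congrArg (fun w : 𝔉.EPiN => (𝔉.sCupPi h1 hcs).range.map (MulAut.conj w).toMonoidHom) ?_
    change 𝔉.envAut (hc.stabilizesEPiN hsec) (𝔉.muIncl ⟨Φ.symm u', hu⟩) = 𝔉.muIncl u'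
    rw [hc.envAut_muIncl hsec]
    exact congrArg 𝔉.muIncl (Subtype.ext (Φ.apply_symm_apply (u' : Aut 𝔉.BN)))

/-- **The automorphism `γ` of the Frobenioid-theoretic mono-theta environment** `E^Π_N` determined by a
compatible pair `(Φ, ψ)` ("`γ` is an automorphism of topological groups which determines an
automorphism of mono-theta environments", Thm. 5.10 (iii), p.334 (PDF p.108)), for any remaining Kummer part
`DK` of `D` that `γ^{±1}` maps into `D`: an `Iso` in abc-iut-L2-t2's sense with underlying map `envAut`.
[cite: MochizukiEtTh2009, Thm 5.10 (iii) p.334 (PDF p.108)] -/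
theorem exists_envIso (h1 : 𝔉.SectionsFactor) (h3 : 𝔉.OuterActionLZ) (hsec : 𝔉.SgpCapSection)
    (hcs : 𝔉.SgpCupSection) (h8 : 𝔉.ConstantsEqNormalizer) (DK : Set (TopOut 𝔉.EPiN))
    (hDK : ∀ d ∈ DK, TopOut.transport (𝔉.envAut (hc.stabilizesEPiN hsec)) d ∈
      (𝔉.frdMonoThetaEnv h1 h3 hsec hcs h8 DK).D)
    (hDK' : ∀ d ∈ DK, TopOut.transport (𝔉.envAut ((hc.symm hsec).stabilizesEPiN hsec)) d ∈
      (𝔉.frdMonoThetaEnv h1 h3 hsec hcs h8 DK).D) :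
    ∃ γ : (𝔉.frdMonoThetaEnv h1 h3 hsec hcs h8 DK).Iso (𝔉.frdMonoThetaEnv h1 h3 hsec hcs h8 DK),
      γ.e = 𝔉.envAut (hc.stabilizesEPiN hsec) :=
  ⟨⟨𝔉.envAut (hc.stabilizesEPiN hsec), hc.map_D_eq_self h1 h3 hsec hcs h8 DK hDK hDK',
    hc.image_sTheta h1 hsec hcs⟩, rfl⟩

end IsEnvCompatible

end Structure

/-! ### Theorem 5.10 (iii) -/

section Thm510iii

/-- **[EtTh] Theorem 5.10 (iii), from a compatible pair.**  If `Φ = κ⁻¹ ∘ Ψ^Aut` (`κ = Inn(k)`) and `(Φ, ψ)` is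
compatible with the §5 data, the induced `γ` satisfies `Ψ^Aut ∘ ϵ = κ ∘ ϵ ∘ γ` and lies over `ψ`:
this is the body of abc-iut-L2-t4's `MonoThetaEnvCompat` for the representative `ψ`, stated UNFOLDED (an automorphism `γ`
of the mono-theta environment `frdMonoThetaEnv … DK` and `k` with `Ψ^Aut(ϵ x) = k · ϵ(γ x) · k⁻¹` and `γ` over `ψ` on
`Π^tp_Y̲`) so that it does not depend on the binder shape of that definition.  `hDK`, `hDK'`: `γ^{±1}` maps the
remaining Kummer part `DK` of `D` into `D` ("`Ψ^birat_Aut` … preserve[s] `(K^×)^{1/N}`").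
[cite: MochizukiEtTh2009, Thm 5.10 (iii) p.334 (PDF p.108)] -/
theorem exists_monoThetaIso_of_isEnvCompatible (h1 : 𝔉.SectionsFactor) (h3 : 𝔉.OuterActionLZ)
    (hsec : 𝔉.SgpCapSection) (hcs : 𝔉.SgpCupSection) (h8 : 𝔉.ConstantsEqNormalizer)
    (DK : Set (TopOut 𝔉.EPiN)) (Ψ : C ≌ C) (β : Ψ.functor.obj 𝔉.BN ≅ 𝔉.BN) (k : Aut 𝔉.BN)
    {Φ : Aut 𝔉.BN ≃* Aut 𝔉.BN} {ψ : 𝔉.PiX ≃ₜ* 𝔉.PiX} (hc : 𝔉.IsEnvCompatible Φ ψ)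
    (hΦ : ∀ a, Φ a = k⁻¹ * 𝔉.psiAut Ψ β a * k)
    (hDK : ∀ d ∈ DK, TopOut.transport (𝔉.envAut (hc.stabilizesEPiN hsec)) d ∈
      (𝔉.frdMonoThetaEnv h1 h3 hsec hcs h8 DK).D)
    (hDK' : ∀ d ∈ DK, TopOut.transport (𝔉.envAut ((hc.symm hsec).stabilizesEPiN hsec)) d ∈
      (𝔉.frdMonoThetaEnv h1 h3 hsec hcs h8 DK).D) :
    ∃ (γ : (𝔉.frdMonoThetaEnv h1 h3 hsec hcs h8 DK).Iso (𝔉.frdMonoThetaEnv h1 h3 hsec hcs h8 DK))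
      (k : Aut 𝔉.BN), (∀ x, 𝔉.psiAut Ψ β (𝔉.epsilon x) = k * 𝔉.epsilon (γ.e x) * k⁻¹) ∧
        ∀ x, 𝔉.toPiY (γ.e x) = ψ (𝔉.toPiY x) := by
  obtain ⟨γ, hγ⟩ := hc.exists_envIso h1 h3 hsec hcs h8 DK hDK hDK'
  refine ⟨γ, k, fun x => ?_, fun x => by rw [hγ]; rfl⟩
  rw [hγ]
  change 𝔉.psiAut Ψ β (𝔉.epsilon x) = k * Φ (𝔉.epsilon x) * k⁻¹
  rw [hΦ]
  group

/-- **Theorem 5.10 (ii) ⇒ the compatibility hypotheses.**  Given `Θ = Ψ^Aut` as an automorphism of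
`Aut_C(B_N)` with the conclusions of Thm. 5.10 (ii) ("`Ψ^Aut` … preserve[s] `O^×(B_N)`" and "map[s] the data `E_N`;
`Im(s^⊔-gp_N)` to `δ₁ · E_N · δ₁⁻¹`; `δ₁ · δ₂ · δ₃ · Im(s^⊔-gp_N) · δ₃⁻¹ · δ₂⁻¹ · δ₁⁻¹`", p.334 (PDF p.108)) and an
automorphism `ψY` of `Π^tp_X̲` lying over `Θ` through `ρ` and preserving `Π^tp_Y̲`, `Π^tp_Ÿ̲`, the pair
`(κ⁻¹ ∘ Θ, Inn(x₃⁻¹) ∘ ψY)` is compatible, where `κ = Inn(δ₁ · δ₂ · δ₃)` (p.335 (PDF p.109)) and `ρ(x₃) = δ₃^bs` ("up to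
composition with an automorphism of `Π^tp_Ÿ` that extends to an automorphism of `Π^tp_X`", p.335 (PDF p.109)).
[cite: MochizukiEtTh2009, Thm 5.10 (iii) p.335 (PDF p.109)] -/
theorem isEnvCompatible_of_thm510ii (h3 : 𝔉.OuterActionLZ)
    (h8 : 𝔉.ConstantsEqNormalizer) (Θ : Aut 𝔉.BN ≃* Aut 𝔉.BN) {δ₁ δ₂ δ₃ : Aut 𝔉.BN}
    (hδ₁ : δ₁ ∈ 𝔉.units 𝔉.BN) (hδ₂ : δ₂ ∈ 𝔉.OKxRootN) (hδ₃ : δ₃ ∈ 𝔉.sgpCap.range)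
    (hU : (𝔉.units 𝔉.BN).map Θ.toMonoidHom = 𝔉.units 𝔉.BN)
    (hE : 𝔉.EN.map Θ.toMonoidHom = MulAut.conj δ₁ • 𝔉.EN)
    (hcup : 𝔉.sgpCup.range.map Θ.toMonoidHom = MulAut.conj (δ₁ * δ₂ * δ₃) • 𝔉.sgpCup.range)
    (ψY : 𝔉.PiX ≃ₜ* 𝔉.PiX) (hbase : ∀ g, 𝔉.autBase 𝔉.BN (Θ (𝔉.sgpCap (𝔉.ρ g))) = 𝔉.ρ (ψY g))
    (hY : 𝔉.PiY.map ψY.toMulEquiv.toMonoidHom = 𝔉.PiY)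
    (hYdd : 𝔉.PiYdd.map ψY.toMulEquiv.toMonoidHom = 𝔉.PiYdd)
    (x₃ : 𝔉.PiX) (hx₃ : 𝔉.ρ x₃ = 𝔉.autBase 𝔉.BN δ₃) :
    𝔉.IsEnvCompatible (Θ.trans (MulAut.conj (δ₁ * δ₂ * δ₃)⁻¹)) (ψY.trans (𝔉.conjTop x₃⁻¹)) := by
  -- `δ₂`, `δ₃` normalise `E_N` (Lemma 5.8; Lemma 5.9 (iii))
  have hδ₂n : δ₂ ∈ Subgroup.normalizer (𝔉.EN : Set (Aut 𝔉.BN)) := by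
    rw [h8] at hδ₂; exact hδ₂.2
  have hδ₃n : δ₃ ∈ Subgroup.normalizer (𝔉.EN : Set (Aut 𝔉.BN)) := by
    obtain ⟨a, rfl⟩ := hδ₃
    obtain ⟨z, rfl⟩ := 𝔉.ρ_surjective a
    exact h3 ⟨z, Subgroup.mem_top z, rfl⟩
  have hn : δ₂ * δ₃ ∈ Subgroup.normalizer (𝔉.EN : Set (Aut 𝔉.BN)) := mul_mem hδ₂n hδ₃n
  have hΦ : ∀ a, (Θ.trans (MulAut.conj (δ₁ * δ₂ * δ₃)⁻¹)) a =
      (δ₂ * δ₃)⁻¹ * (δ₁⁻¹ * Θ a * δ₁) * (δ₂ * δ₃) := by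
    intro a
    rw [MulEquiv.trans_apply, MulAut.conj_apply, inv_inv]
    group
  have hψ : ∀ y, (ψY.trans (𝔉.conjTop x₃⁻¹)) y = x₃⁻¹ * ψY y * x₃ := by
    intro y
    change 𝔉.conjTop x₃⁻¹ (ψY y) = _
    rw [conjTop_apply, inv_inv]
  have hk : 𝔉.autBase 𝔉.BN (δ₁ * δ₂ * δ₃) = 𝔉.ρ x₃ := by
    rw [map_mul, map_mul, hx₃, 𝔉.base_map_units_aut hδ₁,
      𝔉.base_map_units_aut (𝔉.OKxRootN_le_units hδ₂), one_mul, one_mul]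
  refine ⟨?_, ?_, ?_, ?_, ?_, ?_⟩
  · refine map_equiv_eq_of_mem_iff fun a => ?_
    rw [hΦ, ← Subgroup.mem_normalizer_iff''.mp hn, mem_iff_of_map_equiv_eq_conj_smul hE]
  · refine map_equiv_eq_of_mem_iff fun a => ?_
    rw [MulEquiv.trans_apply, MulAut.conj_apply, (𝔉.units_normal 𝔉.BN).mem_comm_iff,
      ← mul_assoc, inv_mul_cancel, one_mul, mem_iff_of_map_equiv_eq hU]
  · refine map_equiv_eq_of_mem_iff fun a => ?_
    rw [MulEquiv.trans_apply, MulAut.conj_apply, inv_inv, mem_iff_of_map_equiv_eq_conj_smul hcup]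
  · intro g
    rw [MulEquiv.trans_apply, MulAut.conj_apply, inv_inv, map_mul, map_mul, map_inv, hbase, hk, hψ,
      map_mul, map_mul, map_inv]
  · refine map_equiv_eq_of_mem_iff (Φ := (ψY.trans (𝔉.conjTop x₃⁻¹)).toMulEquiv) fun y => ?_
    change (ψY.trans (𝔉.conjTop x₃⁻¹)) y ∈ 𝔉.PiY ↔ y ∈ 𝔉.PiY
    haveI := 𝔉.PiY_normal
    rw [hψ, ← Subgroup.mem_normalizer_iff''.mp (Subgroup.normalizer_eq_top (H := 𝔉.PiY) ▸
      Subgroup.mem_top x₃)]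
    exact mem_iff_of_map_equiv_eq (Φ := ψY.toMulEquiv) hY y
  · refine map_equiv_eq_of_mem_iff (Φ := (ψY.trans (𝔉.conjTop x₃⁻¹)).toMulEquiv) fun y => ?_
    change (ψY.trans (𝔉.conjTop x₃⁻¹)) y ∈ 𝔉.PiYdd ↔ y ∈ 𝔉.PiYdd
    haveI := 𝔉.PiYdd_normal
    rw [hψ, ← Subgroup.mem_normalizer_iff''.mp (Subgroup.normalizer_eq_top (H := 𝔉.PiYdd) ▸
      Subgroup.mem_top x₃)]
    exact mem_iff_of_map_equiv_eq (Φ := ψY.toMulEquiv) hYdd y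

/-- **[EtTh] Theorem 5.10 (iii), discharged modulo Theorem 5.10 (ii).**  From abc-iut-L2-t4's typed
Theorem 5.10 (ii) `PsiAutPreserves Ψ β Ψ^birat_Aut` (its clauses "`Ψ^Aut` preserve[s] `O^×(B_N)`" and
"map[s] the data `E_N`; `Im(s^⊔-gp_N)` to `δ₁ · E_N · δ₁⁻¹`; `δ₁ · δ₂ · δ₃ · Im(s^⊔-gp_N) · δ₃⁻¹ · δ₂⁻¹ · δ₁⁻¹`",
p.334 (PDF p.108)), a representative `ψY` of "the `Π^tp_X`-conjugacy class of automorphisms of `Π^tp_Y` induced by `Ψ^bs`"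
lying over `Ψ^Aut` through `ρ` (Thm. 4.4 (i); Def. 4.1 (ii)) and preserving `Π^tp_Y̲`, `Π^tp_Ÿ̲` (Prop. 2.4),
and the stability of the remaining Kummer part `DK` of `D` under compatible pairs ("`Ψ^birat_Aut` …
preserve[s] `(K^×)^{1/N}`"): "there exists a commutative diagram `Ψ^Aut ∘ ϵ = (κ ∘ ϵ) ∘ γ` — where `κ` is an
inner automorphism of `Aut_C(B_N)`; `γ` is an automorphism of topological groups which determines an
automorphism of mono-theta environments and is compatible with the `Π^tp_X`-conjugacy class of
automorphisms of `Π^tp_Y` induced by `Ψ^bs`" — stated UNFOLDED (independent of the binder shape of abc-iut-L2-t4's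
`MonoThetaEnvCompat`; the assembly `Discharge/Sec5Thm510.lean` rewraps it): for some `x₃ ∈ Π^tp_X̲` there are an
automorphism `γ` of the mono-theta environment and `k ∈ Aut_C(B_N)` with `Ψ^Aut(ϵ x) = k · ϵ(γ x) · k⁻¹` and `γ` lying over
the representative `Inn(x₃⁻¹) ∘ ψY` of that class; `κ = Inn(δ₁ · δ₂ · δ₃)` as in the printed proof (p.335 (PDF p.109)) and
`γ = (κ⁻¹ ∘ Ψ^Aut, Inn(x₃⁻¹) ∘ ψY)|_{E^Π_N}` directly.  [cite: MochizukiEtTh2009, Thm 5.10 (iii) p.334–335 (PDF pp.108–109)] -/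
theorem exists_monoThetaIso_of_psiAutPreserves (h1 : 𝔉.SectionsFactor)
    (h3 : 𝔉.OuterActionLZ) (hsec : 𝔉.SgpCapSection) (hcs : 𝔉.SgpCupSection)
    (h8 : 𝔉.ConstantsEqNormalizer) (DK : Set (TopOut 𝔉.EPiN)) (Ψ : C ≌ C)
    (β : Ψ.functor.obj 𝔉.BN ≅ 𝔉.BN) (ΨbiratAut : 𝔉.biratUnits 𝔉.BN ≃* 𝔉.biratUnits 𝔉.BN)
    (hii : 𝔉.PsiAutPreserves Ψ β ΨbiratAut) (ψY : 𝔉.PiX ≃ₜ* 𝔉.PiX)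
    (hbase : ∀ g, 𝔉.autBase 𝔉.BN (𝔉.psiAut Ψ β (𝔉.sgpCap (𝔉.ρ g))) = 𝔉.ρ (ψY g))
    (hY : 𝔉.PiY.map ψY.toMulEquiv.toMonoidHom = 𝔉.PiY)
    (hYdd : 𝔉.PiYdd.map ψY.toMulEquiv.toMonoidHom = 𝔉.PiYdd)
    (hDK : ∀ {Φ : Aut 𝔉.BN ≃* Aut 𝔉.BN} {ψ : 𝔉.PiX ≃ₜ* 𝔉.PiX} (hc : 𝔉.IsEnvCompatible Φ ψ),
      ∀ d ∈ DK, TopOut.transport (𝔉.envAut (hc.stabilizesEPiN hsec)) d ∈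
        (𝔉.frdMonoThetaEnv h1 h3 hsec hcs h8 DK).D) :
    ∃ (x₃ : 𝔉.PiX) (γ : (𝔉.frdMonoThetaEnv h1 h3 hsec hcs h8 DK).Iso (𝔉.frdMonoThetaEnv h1 h3 hsec hcs h8 DK))
      (k : Aut 𝔉.BN), (∀ x, 𝔉.psiAut Ψ β (𝔉.epsilon x) = k * 𝔉.epsilon (γ.e x) * k⁻¹) ∧
        ∀ x, 𝔉.toPiY (γ.e x) = (ψY.trans (𝔉.conjTop x₃⁻¹)) (𝔉.toPiY x) := by
  obtain ⟨hU, -, -, -, δ₁, δ₂, δ₃, hδ₁, hδ₂, hδ₃, hE, -, hcup⟩ := hii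
  obtain ⟨x₃, hx₃⟩ := 𝔉.ρ_surjective (𝔉.autBase 𝔉.BN δ₃)
  have hc := isEnvCompatible_of_thm510ii h3 h8 (𝔉.psiAutEquiv Ψ β) hδ₁ (Subgroup.mem_inf.mp hδ₂).2
    hδ₃ (by rwa [psiAutEquiv_toMonoidHom]) (by rwa [psiAutEquiv_toMonoidHom])
    (by rwa [psiAutEquiv_toMonoidHom]) ψY (fun g => hbase g) hY hYdd x₃ hx₃
  exact ⟨x₃, exists_monoThetaIso_of_isEnvCompatible h1 h3 hsec hcs h8 DK Ψ β (δ₁ * δ₂ * δ₃) hc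
    (fun a => by rw [MulEquiv.trans_apply, MulAut.conj_apply, inv_inv, psiAutEquiv_apply])
    (hDK hc) (hDK (hc.symm hsec))⟩

end Thm510iii

end ThetaFrobenioid

end Literature.AnabelianGeometry.EtaleTheta
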